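import Summits.ResolutionOfSingularities.ResolutionOfSingularities.Theorems.FrobeniusClosingPatchingRelPerfectDepthMixedTargetsJR
import Summits.ResolutionOfSingularities.ResolutionOfSingularities.Theorems.FrobeniusClosingPatchingRelPerfectDepthMixedTargetsJCompositions
import HarnessLib

/-!
# Chain W5.2 — «F6»: the NON-GRADED depth-two ONE-FORM engine — flag order reduction (stage 1) ⇒ regular host ⇒
# SEPARATION of two regular hypersurfaces (stage 2) ⇒ two-monomial END ⇒ pointwise pair game

FILER'S NOTE (res-D-pv-059 AS res-L1-w52-lead-2): plan-1's `ChainW52TargetsF6.lean` v1.1 (sha16 7001d3757fbb0aa3, 678 l.) is landed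
VERBATIM in THREE modules because Theorems files are capped at 400 lines: `…DepthFlagTargets` (§1–§3: stage 1 + junction, this
module's siblings import it), `…DepthSepTargets` (§4–§6: stage 2 + the engines), `…DepthFlagSepCompositions` (§7: the PROVED
compositions).  Declarations, docstrings and their order are byte-identical to v1.1; only the module boundaries are the filer's.

[OURS · L1 W5.2 · res-L1-w52-plan-1 gen 8 · TargetsF6 v1.1 (part F = stage 1 + junction, part S = stage 2; supersedes the part-S
draft v0 078cf7ab, whose DEFINITIONS are kept byte-identical; v1.1 = v1 c3ff6800 with docstrings realigned to the landed
`DepthGraded.SepFormat` p520204 and the holders of 10:15Z — DECLARATIONS byte-identical to v1)]  NOT a statement of the manuscript under review (Hironaka 2017);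
AI-typed, weaker than expert review.  FACT-FREE except inside `SeparationBoundary₃` (F-32bR `CossartJannsenSaito2020EmbeddedSequenceB`
as an antecedent, exactly as T5-E `WeightTwoBoundaryJR₃`).  F-33 (Cossart–Piltant 2008 Prop. 4.4) is NOT admissible and does NOT
occur in this file: the intended closer of `StageOneFlagScoped₃` carries it as an explicit binder labelled CONDITIONAL, in its own
module (res-L1-w52-idea-1 card C architecture).

THE MEMBER CLASS.  One-form depth-two members of the CORE (`stub_atomDimFourBlowup`, `S` regular local of dimension four,
equicharacteristic with perfect residue field): after the first blowing up `X₁ = Bl_𝔪 Spec S ⊃ E ≅ ℙ³`, `I𝒪 = 𝓘_E^d · K` with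
`K = 𝓗 ⊔ 𝓘_E²`, `𝓗 = (F)` an effective Cartier divisor (the host), locally `F = r^*f̄ + t·g` along a retraction `r` (`t` an
equation of `E`).  The graded sub-case `g = 0` is F5 (tree: `…DepthMixedTargetsJR*`, `…DepthOneFormGradedRecord`).

THE MECHANISM (F6-DESIGN-MEMO c3041ebc; kernel sentence v1.9 (i′); KEY OBSERVATION proved three ways: res-type-003 (ring),
res-L1-w52-tri-2 (converse), res-L1-w52-stub-1 p518040 `DepthFlag.idealOrder_le_one_iff_flag` /
`exists_generator_host_not_mem_sq_of_flag` (coordinate-free, OF RECORD)).  The E-side datum of a member is the COEFFICIENT FLAG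
`R₂ = coeffFlag 0 K = K|_E = (f̄) ≤ R₁ = coeffFlag 1 K = (f̄, ḡ)` (res-L1-w52-lead-1 `DepthGraded.coeffFlag`); X-side weight-two
permissibility `K ≤ 𝓘_{i(C)}²` ⟺ `R₂ ≤ C² ∧ R₁ ≤ C` (lead-1 `le_map_pow_of_coeffFlag_le`, `le_centrePow_iff`), i.e. the flag is the
single marked ideal `(𝒥, 2)`, `𝒥 := R₂ ⊔ R₁²`.
* STAGE 1 (§1–§2): PURE WEIGHT-TWO order reduction of `(𝒥, 2)` on the regular excellent threefold `E` — every centre lies in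
  `Sing(𝒥, 2)`, the X-side keeps LITERAL maximal contact (`DepthInvariant 2`, step = F1 `DictionaryStepPow 2`), the flag transforms by
  `R₂' = τᶜ(R₂, 2)`, `R₁' = τᶜ(R₂, 2) ⊔ τᶜ(R₁, 1)` (lead-1 G4a `coeffFlag_controlledTransform_eq_of_charts`, `ℓ = 2`, `b = 1`).
  NO boundary list, NO exponents, NO connectedness are carried (tri-1 / tri-2 q1″(a): no loss — stage-1-born exceptional surfaces
  are never N-charged, their traces are ordinary components of `V(𝔟)` for stage 2).  END₁ = `EndFlag`: `ord_x 𝒥 ≤ 1` everywhere.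
* KEY OBSERVATION = JUNCTION (§3): at END₁ the host `H = V(𝓗)` is REGULAR at every point of `H ∩ E = cosupp K ∩ i(E)` (a generator
  of `𝓗_{ix}` outside `𝔪²`), so the member is `𝓘_H ⊔ 𝓘_E²` with `H`, `E` two regular hypersurfaces of the regular fourfold; the
  stage-2 format `Q` is established with `N = ⊤` and the empty boundary (`InitialSep Q₁ Q`, owner res-D-pv-016 AS stub-5).
* STAGE 2 (§4–§5, = part S v0): SEPARATION of `H` from `E` by WEIGHT-ONE steps keyed on `𝔟 := 𝓗|_E` (connected regular centres in
  `V(𝔟)`, PEEL steps allowed, order-guarded JOINT clause, N-charging of every new exceptional divisor), END₂ = `EndSep`, then the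
  two-monomial END LITERALLY in the shape of `EndTwoMonomialJR` and T5-M `PointwisePairGame` (`pointwisePairGame_holds`, p515425) ⇒
  the CORE conclusion by `atomConclusion_of_pointwiseTwoMonomial`.
* E-DRIVERS: T6-E1 `StageOneFlag₃` (fact-free, UNSCOPED) = `StageOnePrephase₃` (tri-2's divisorial pre-phase: CJS Phase A on
  `V(h)_red` + PEEL, all weight two, reaching the scope condition `FlagScope`) THEN `StageOneFlagScoped₃` (tri-1 v11.1 scope clause;
  = card C's slot: companion cascade, CONDITIONAL on F-33, residuals ⟨`CompanionDescent`, `Prop44B`, `ContactSeparation₂`⟩ as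
  idea-1 / tri-1 name them) — glued here by `IsFlagSeq.trans` (`stageOneFlag₃_of_prephase_of_scoped`, PROVED); T6-E2
  `SeparationBoundary₃` (F-32bR^B; holder res-L1-w52-stub-1 g4).
* NOT HERE: the member-level corollary («F6b», as F5b/`…DepthOneFormGradedRecord`): once res-D-pv-055's `taylorPackageTwo` /
  `exists_taylor_presentation` (initial state: `DepthInvariant 2`, host export, flag identification `R₂ = 𝓟(P₀)`,
  `R₁ = 𝓟(P₀) ⊔ 𝓟(P₁)`) and lead-1's `FlagFormat` (the instance of `Q₁`, with `LocallyTrivialPair`) are in the tree, lead-2 records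
  `oneFormMember_atomConclusion` from `flagEngineTwo_threefold`.  Multi-form depth two (host not Cartier) = F6′, later.

CONTENTS.  §1 stage-1 E-side (`IsFlagSeq`, `EndFlag`, `FlagScope`, `FlagState₃`, `StageOneFlag₃`, `StageOnePrephase₃`,
`StageOneFlagScoped₃`) · §2 stage-1 X-side generic in `Q₁ i K R₁` (`StepFlagTwo`, `TowerFlagTwo`) · §3 junction (`InitialSep Q₁ Q`) ·
§4 stage-2 E-side (`OrdLeOneAt`, `CoincidesAt`, `chargedOf`, `SepJointAt`, `IsSepSeq`, `EndSep`, `SeparationBoundary₃`) · §5 stage-2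
X-side generic in `Q i K N 𝒟` (`StepSepOne`, `TowerSep`, `EndTwoMonomialSep`) · §6 engines (`SepEngine Q`, `FlagEngineTwo Q₁`) ·
§7 PROVED compositions (`IsFlagSeq.isPureWeightedSeq/.trans/.le`, `stageOneFlag₃_of_prephase_of_scoped`,
`towerFlagTwo_of_stepFlagTwo`, `IsSepSeq.isWeightedSeq`, `towerSep_of_stepSepOne`, `sepEngine_of_targets`, `sepEngine_threefold`,
`flagEngineTwo_of_targets`, `flagEngineTwo_threefold`).  Filer (res-D-pv-059 AS lead-2): split §7 into a `…Compositions` module if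
convenient; `--supports stmt-ResolutionOfSingularities-16161 --as helper`.

OWNERS (rulings 09:17:34Z / 09:49:21Z / STEER 09:59:52Z + 10:15Z).  `StepFlagTwo Q₁` for `Q₁ := FlagFormat`: res-L1-w52-lead-1 (T6-0 + T6-X1) · `InitialSep`,
`StepSepOne`, E′-half of `EndTwoMonomialSep` for `Q := DepthGraded.SepFormat`: res-D-pv-016 AS stub-5 (T6-X2; bricks res-D-pv-021
host transport, res-D-pv-009 p519194 swaps + pocket field p512884 / p516978, res-D-pv-052 `sncWithAt_host_cons`) · pocket half of
`EndTwoMonomialSep`: res-D-pv-009 · `StageOneFlagScoped₃`: idea-1 card C engine (CONDITIONAL) ·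
`StageOnePrephase₃`: res-type-049 g11 · `SeparationBoundary₃`: res-L1-w52-stub-1 g4 (TAKING 09:49:12Z; T5-E bricks (L-A)…(L-G),
`WeightTwoB.cjs_transport` p520851 reusable verbatim) · bookkeeping: res-type-003 (`IsFlagSeq`, PEEL steps), res-D-pv-021 (`IsSepSeq`,
trace→cotangent feeders) · initial package: res-D-pv-055 ·
`PointwisePairGame`: tree (stub-1) · record module: lead-2.

WITNESSES settled by hand (memo §5, re-run by tri-1 v10/v11 and tri-2 v9): peel ladder `t + f(v)`; coincidence `t + h²`; `d·b + t·g`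
(`g` a unit where `ord 𝔟 ≥ 2`); stage-1 example `(h² + t g, t²)`; triple contact `h = y³ − x⁴` (tri-1 ERRATUM 09:27:24Z: contact
separation is owed INSIDE `Sing(𝒥', 2)`, whence `ContactSeparation₂` among the scoped closer's residuals — not a clause of the target).
-/

-- `Summit.<Summit>.<Sub>.Theorems` with `Sub = Summit` (single-conjunct summit, D-0017)
set_option linter.dupNamespace false

noncomputable section

open CategoryTheory CategoryTheory.Limits AlgebraicGeometry TopologicalSpace
open Literature.AlgebraicGeometry.Resolution
open Scheme.IdealSheafData

namespace Summit.ResolutionOfSingularities.ResolutionOfSingularities.Theorems.DepthTargets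

universe u

/-! ## §1 STAGE 1, E-side: pure weight-two sequences driven by the coefficient flag -/

/-- [OURS · L1 W5.2] **`IsFlagSeq ρ 𝔟 R₁ 𝔟' R₁'` — WEIGHT-TWO sequences driven by the coefficient flag** (stage 1 of F6):
`ρ : E' ⟶ E` is a composite of blowings up in regular centres `C` which are flag-permissible — `𝔟' ≤ C²` and `R₁' ≤ C`, i.e.
`C ⊆ Sing(𝔟' ⊔ R₁'², 2)`, equivalently (lead-1 `le_map_pow_of_coeffFlag_le` / `le_centrePow_iff`) the X-side step along `i(C)`
is permissible with weight two — the state `(𝔟', R₁')` = (zeroth, first term of the flag) being transported by the flag laws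
`𝔟'' = τᶜ(𝔟', 2)`, `R₁'' = τᶜ(𝔟', 2) ⊔ τᶜ(R₁', 1)` (lead-1 G4a with `ℓ = 2`, `b = 1`).  No boundary, no exponents, no
connectedness (surface centres = PEEL steps are allowed: `τ` is then an isomorphism).
[cite: KawanoueMatsuki2016, §2 (transformation rule)] [cite: BierstoneGrigorievMilmanWlodarczyk2011, Def. 3.1.3, §3.2] -/
inductive IsFlagSeq :
    ∀ {E' E : Scheme.{u}}, (E' ⟶ E) → E.IdealSheafData → E.IdealSheafData →
      E'.IdealSheafData → E'.IdealSheafData → Prop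
  /-- the empty sequence -/
  | nil {E : Scheme.{u}} (𝔟 R₁ : E.IdealSheafData) : IsFlagSeq (𝟙 E) 𝔟 R₁ 𝔟 R₁
  /-- one more blowing up along a regular flag-permissible centre (`𝔟' ≤ C²`, `R₁' ≤ C`), the flag transported by the
  weight-two laws -/
  | cons {E'' E' E : Scheme.{u}} (τ : E'' ⟶ E') (ρ : E' ⟶ E) (𝔟 R₁ : E.IdealSheafData)
      (𝔟' R₁' : E'.IdealSheafData) (C : E'.IdealSheafData) :
      IsFlagSeq ρ 𝔟 R₁ 𝔟' R₁' →
      Scheme.IsRegular C.subscheme → 𝔟' ≤ C ^ 2 → R₁' ≤ C → IsBlowup τ C →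
      IsFlagSeq (τ ≫ ρ) 𝔟 R₁ (controlledTransform τ C 𝔟' 2)
        (controlledTransform τ C 𝔟' 2 ⊔ controlledTransform τ C R₁' 1)

/-- [OURS · L1 W5.2] **END₁ = `EndFlag 𝔟 R₁`: the flag marked ideal `(𝔟 ⊔ R₁², 2)` has order at most one at every point**
(`Sing(𝒥, 2) = ∅`; no weight-two-permissible centre survives).  By the KEY OBSERVATION (stub-1
`DepthFlag.exists_generator_host_not_mem_sq_of_flag`) this is exactly «the host is regular along `E`».  (At points off `V(𝔟)`
the order is `0`, so the unguarded `∀ x` is harmless.) [cite: KawanoueMatsuki2016, §2] -/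
def EndFlag {E : Scheme.{u}} (𝔟 R₁ : E.IdealSheafData) : Prop :=
  ∀ x : E, idealOrder (𝔟 ⊔ R₁ ^ 2) x ≤ 1

/-- [OURS · L1 W5.2] **The SCOPE CONDITION `FlagScope 𝔟 R₁`** (tri-1 TRIAGE v11.1, retraction-invariant form): the
weight-two-permissible locus `Sing(𝔟 ⊔ R₁², 2)` has NO DIVISORIAL PART — every point of order `≥ 2` has codimension `≥ 2` in `E`
(`Order.coheight x = dim 𝒪_{E,x}`, `ringKrullDim_stalk_eq_coheight`).  For `𝔟 = (f̄)`, `R₁ = (f̄, ḡ)` on `E = ℙ³`: no `h` with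
`h² ∣ f̄ ∧ h ∣ ḡ`.  Reached from any state by the divisorial pre-phase (`StageOnePrephase₃`). [cite: CossartPiltant2008, Prop. 4.4] -/
def FlagScope {E : Scheme.{u}} (𝔟 R₁ : E.IdealSheafData) : Prop :=
  ∀ x : E, (2 : ℕ∞) ≤ idealOrder (𝔟 ⊔ R₁ ^ 2) x → 1 < Order.coheight x

/-- [OURS · L1 W5.2] **Bookkeeping clauses of a stage-1 output state `(E', 𝔟', R₁')`** (what stage 2's driver needs of its
input, plus the flag shape): `E'` integral, Noetherian, regular, excellent, of dimension three; `𝔟'` non-zero and locally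
principal; `𝔟' ≤ R₁'`.  All are ROUTINE along an `IsFlagSeq` from such an `E` (blowing up a regular centre: `isExcellent_of_isBlowup`,
(L-A) `IsBlowup.controlledTransform` of a Cartier divisor, `IsFlagSeq.le`) — generic bricks `IsFlagSeq.flagState₃` are welcome
(`--supports 16161`), until then the drivers discharge them. [folklore] -/
def FlagState₃ (E' : Scheme.{u}) (𝔟' R₁' : E'.IdealSheafData) : Prop :=
  IsIntegral E' ∧ IsNoetherian E' ∧ Scheme.IsRegular E' ∧ Scheme.IsExcellent E' ∧ topologicalKrullDim E' = 3 ∧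
    𝔟' ≠ ⊥ ∧ IsLocallyPrincipal 𝔟' ∧ 𝔟' ≤ R₁'

/-- [OURS · L1 W5.2] **TARGET T6-E1 «FLAG ORDER REDUCTION» `StageOneFlag₃`** (E-side driver of stage 1; fact-free, UNSCOPED; L,
multi-session): on an integral Noetherian regular excellent threefold `E`, every flag `𝔟 ≤ R₁` with `𝔟` non-zero locally principal is
carried by an `IsFlagSeq` (weight-two, flag-permissible regular centres) to a state with `ord (𝔟' ⊔ R₁'²) ≤ 1` everywhere.
= `StageOnePrephase₃` THEN `StageOneFlagScoped₃` (`stageOneFlag₃_of_prephase_of_scoped`, PROVED below); no holder attacks this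
Prop directly.  Why it might fail: only through its two halves (see there).
(cf. Cossart–Piltant 2008 = bib CossartPiltant2008, Prop. 4.4; Kawanoue–Matsuki 2016 = bib KawanoueMatsuki2016, §2 — OURS node;
pointer in prose, the Prop being parameterless) -/
def StageOneFlag₃ : Prop :=
  ∀ (E : Scheme.{u}) [IsIntegral E] [IsNoetherian E], Scheme.IsRegular E → Scheme.IsExcellent E →
    topologicalKrullDim E = 3 →
    ∀ (𝔟 R₁ : E.IdealSheafData), 𝔟 ≠ ⊥ → IsLocallyPrincipal 𝔟 → 𝔟 ≤ R₁ →
      ∃ (E' : Scheme.{u}) (ρ : E' ⟶ E) (𝔟' R₁' : E'.IdealSheafData),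
        IsFlagSeq ρ 𝔟 R₁ 𝔟' R₁' ∧ FlagState₃ E' 𝔟' R₁' ∧ EndFlag 𝔟' R₁'

/-- [OURS · L1 W5.2] **TARGET T6-E1a «DIVISORIAL PRE-PHASE» `StageOnePrephase₃`** (fact-free except that its intended proof uses
F-32bR Phase A; M): every flag is carried by weight-two flag-permissible steps to a state satisfying the SCOPE CONDITION.  Intended
route (tri-2 TRIAGE v9 / memo §2.1): write the divisorial part of `Sing(𝔟 ⊔ R₁², 2)` as `V(h)` (`h² ∣ 𝔟`, `h ∣ R₁` locally);
(1) CJS Phase A (F-32bR) on `V(h)_red` — its centres `Z ⊆ Sing V(h)_red` are flag-permissible (`h ∈ 𝓘_Z`, so `𝔟 ≤ 𝓘_Z²`,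
`R₁ ≤ 𝓘_Z`) — until `V(h)_red` is regular, i.e. a disjoint union of regular surfaces `S`; (2) PEEL: centre `C = 𝓘_S` (a Cartier
divisor: `τ` is an isomorphism, `τᶜ(𝔟, 2) = 𝔟·𝓘_S⁻²`, `τᶜ(R₁, 1) = R₁·𝓘_S⁻¹`), permissible while `S` has multiplicity `≥ 2` in `𝔟`
and `≥ 1` in `R₁`; terminates by total multiplicity; at the end no surface lies in `Sing(·, 2)`.  Why it might fail: after Phase A
the components of `V(h)_red` through a point need not be the SAME as the local prime factors used for the multiplicity count
(embedded bookkeeping of a non-reduced divisor along CJS steps — carry `𝔟 = ∏ 𝓘_{S_j}^{a_j} · 𝔟₀` as the driver's invariant, as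
res-D-pv-054 carries `𝔟 = D · monomialIdeal ℬ` in T5-E).  Holder: res-type-049 g11 (dealt 10:15Z; no boundary in stage 1, so plain
F-32bR suffices for Phase A; ISO-tolerant transport as `WeightTwoB.cjs_transport` p520851; bricks (L-A) p512756/p513423, (L-D),
P2 p510611, PEEL bookkeeping res-type-003 verbatim).
(cf. Cossart–Jannsen–Saito 2020 = bib CossartJannsenSaito2020, Thm. 1.4 — OURS node; pointer in prose, the Prop being parameterless) -/
def StageOnePrephase₃ : Prop :=
  ∀ (E : Scheme.{u}) [IsIntegral E] [IsNoetherian E], Scheme.IsRegular E → Scheme.IsExcellent E →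
    topologicalKrullDim E = 3 →
    ∀ (𝔟 R₁ : E.IdealSheafData), 𝔟 ≠ ⊥ → IsLocallyPrincipal 𝔟 → 𝔟 ≤ R₁ →
      ∃ (E' : Scheme.{u}) (ρ : E' ⟶ E) (𝔟' R₁' : E'.IdealSheafData),
        IsFlagSeq ρ 𝔟 R₁ 𝔟' R₁' ∧ FlagState₃ E' 𝔟' R₁' ∧ FlagScope 𝔟' R₁'

/-- [OURS · L1 W5.2] **TARGET T6-E1b «SCOPED FLAG ORDER REDUCTION» `StageOneFlagScoped₃`** (fact-free AS A TARGET; its intended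
closer is CONDITIONAL: binder F-33 `CossartPiltant2008_prop44` — NOT an admissible premise of this chain — plus the residuals named by
res-L1-w52-idea-1 card C / tri-1 v11.1 ⟨`CompanionDescent`, `Prop44B`, `ContactSeparation₂`⟩; L, multi-session): under the SCOPE
CONDITION (`Sing(𝒥, 2)` of codimension `≥ 2`, `𝒥 = 𝔟 ⊔ R₁²`), weight-two flag-permissible steps reach `ord 𝒥' ≤ 1` everywhere.
Intended route = idea-1's COMPANION CASCADE (Sketch v6 ea48b604: `𝒥 = M · J♮`, child phases `exists_childCascade` ∀N PROVED, companion
phases `(J♮, μ) + (M, N − μ)` driven by F-33 on `E` regular excellent of dimension three, monomial end game by the tree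
`exists_isResolutionOf_monomialTimes`; every centre inside `Sing(𝒥_j, 2)` by `natCast_le_idealOrder_mul_of_mem_support_companion`).
Why it might fail: a companion-phase centre prescribed by F-33 for `(J♮, μ)` need not respect the snc boundary accumulated by earlier
phases (`Prop44B` genuinely residual, idea-1 ROUND 7), and contact of `V(f̄')` with a companion component of order exactly two can
re-create order `≥ 3` after a weight-two step unless separated first (`ContactSeparation₂`, tri-1 ERRATUM 09:27:24Z, witness
`h = y³ − x⁴`).
(cf. Cossart–Piltant 2008 = bib CossartPiltant2008, Prop. 4.4; Encinas–Villamayor / Kollár 2007 = bib Kollar2007, 3.111 — OURS node;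
pointer in prose, the Prop being parameterless) -/
def StageOneFlagScoped₃ : Prop :=
  ∀ (E : Scheme.{u}) [IsIntegral E] [IsNoetherian E], Scheme.IsRegular E → Scheme.IsExcellent E →
    topologicalKrullDim E = 3 →
    ∀ (𝔟 R₁ : E.IdealSheafData), 𝔟 ≠ ⊥ → IsLocallyPrincipal 𝔟 → 𝔟 ≤ R₁ → FlagScope 𝔟 R₁ →
      ∃ (E' : Scheme.{u}) (ρ : E' ⟶ E) (𝔟' R₁' : E'.IdealSheafData),
        IsFlagSeq ρ 𝔟 R₁ 𝔟' R₁' ∧ FlagState₃ E' 𝔟' R₁' ∧ EndFlag 𝔟' R₁'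

/-! ## §2 STAGE 1, X-side: generic in a stage-1 format `Q₁ i K R₁` -/

/-- [OURS · L1 W5.2] **`StepFlagTwo Q₁` — the formatted WEIGHT-TWO step of stage 1**: at a state of the depth-two invariant
with LITERAL maximal contact (`DepthInvariant 2`) in format `Q₁ i K R₁` (owner res-L1-w52-lead-1; intended instance `FlagFormat`:
a retraction pair `k : E ⟶ V`, `r : V ⟶ E` on an open `V ⊇ i(E)` of `X` with `LocallyTrivialPair k r`, an effective Cartier host
`𝓗` with `HostMonoFormat 2 i K 𝓗 ⊤`, and `coeffFlag k r 1 K = R₁`; `coeffFlag k r 0 K = K|_E` holds by `coeffFlag_zero`), every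
`IsFlagSeq.cons` datum on the E-side (`K|_E ≤ C²`, `R₁ ≤ C`, `C` regular, `τ = Bl_C`) is matched by the blowing up `σ` of `X` along
`i(C)` with weight TWO: permissibility by `le_map_pow_of_coeffFlag_le` (p507375), the invariant by F1 `DictionaryStepPow 2`
(`dictionaryStepPow_holds`), the restriction law `K'|_{E'} = τᶜ(K|_E, 2)`, and `Q₁` again with the transported first flag term
`τᶜ(K|_E, 2) ⊔ τᶜ(R₁, 1)` (G4a `coeffFlag_controlledTransform_eq_of_charts`, `Finset.range 2`; chart data `FlagChartAt` from G3/G3b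
and `IsBlowup.retractLift`).  No codimension hypothesis on `C` (PEEL centres included; `HostMonoFormat.step`).
[cite: KawanoueMatsuki2016, §2] [cite: BierstoneGrigorievMilmanWlodarczyk2011, §3.2 Lemma 3.2.1] -/
def StepFlagTwo (Q₁ : ∀ ⦃E X : Scheme.{u}⦄, (E ⟶ X) → X.IdealSheafData → E.IdealSheafData → Prop) : Prop :=
  ∀ (S : Type u) [CommRing S] [IsRegularLocalRing S] (I : Ideal S)
    (E X : Scheme.{u}) (i : E ⟶ X) (g : X ⟶ Spec (.of S)) (K : X.IdealSheafData) (R₁ : E.IdealSheafData),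
    DepthInvariant 2 S I E X i g K → Q₁ i K R₁ →
    ∀ (E' : Scheme.{u}) (τ : E' ⟶ E) (C : E.IdealSheafData),
      Scheme.IsRegular C.subscheme → K.comap i ≤ C ^ 2 → R₁ ≤ C → IsBlowup τ C →
        K ≤ C.map i ^ 2 ∧
        ∃ (X' : Scheme.{u}) (σ : X' ⟶ X) (i' : E' ⟶ X'),
          IsBlowup σ (C.map i) ∧ i' ≫ σ = τ ≫ i ∧
          DepthInvariant 2 S I E' X' i' (σ ≫ g) (controlledTransform σ (C.map i) K 2) ∧
          (controlledTransform σ (C.map i) K 2).comap i' = controlledTransform τ C (K.comap i) 2 ∧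
          Q₁ i' (controlledTransform σ (C.map i) K 2)
            (controlledTransform τ C (K.comap i) 2 ⊔ controlledTransform τ C R₁ 1)

/-- [OURS · L1 W5.2] **`TowerFlagTwo Q₁` — the WEIGHT-TWO TOWER of stage 1**: every `IsFlagSeq` on the E-side starting from
`(K|_E, R₁)` is matched by a pure weight-two sequence `π : X' ⟶ X` with literal contact, `K'|_{E'} = 𝔟'` and `Q₁` at the end.
PROVED from `StepFlagTwo Q₁` (`towerFlagTwo_of_stepFlagTwo`, pattern `towerPow_of_stepPow` p-S-T). [cite: Kollar2007, 3.30.2] -/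
def TowerFlagTwo (Q₁ : ∀ ⦃E X : Scheme.{u}⦄, (E ⟶ X) → X.IdealSheafData → E.IdealSheafData → Prop) : Prop :=
  ∀ (S : Type u) [CommRing S] [IsRegularLocalRing S] (I : Ideal S)
    (E X : Scheme.{u}) (i : E ⟶ X) (g : X ⟶ Spec (.of S)) (K : X.IdealSheafData) (R₁ : E.IdealSheafData),
    DepthInvariant 2 S I E X i g K → Q₁ i K R₁ →
    ∀ (E' : Scheme.{u}) (ρ : E' ⟶ E) (𝔟' R₁' : E'.IdealSheafData),
      IsFlagSeq ρ (K.comap i) R₁ 𝔟' R₁' →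
        ∃ (X' : Scheme.{u}) (π : X' ⟶ X) (i' : E' ⟶ X') (K' : X'.IdealSheafData),
          IsPureWeightedSeq 2 π K K' ∧ i' ≫ π = ρ ≫ i ∧
          DepthInvariant 2 S I E' X' i' (π ≫ g) K' ∧ K'.comap i' = 𝔟' ∧ Q₁ i' K' R₁'

/-! ## §3 The JUNCTION: END₁ establishes the stage-2 format with the empty boundary -/

/-- [OURS · L1 W5.2] **TARGET T6-J `InitialSep Q₁ Q` — from END₁ to the stage-2 format** (owner res-D-pv-016 AS stub-5, for
`Q₁ := FlagFormat`, `Q := DepthGraded.SepFormat`): at a stage-1 state (`DepthInvariant 2`, `Q₁ i K R₁`) with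
`EndFlag (K|_E) R₁`, the stage-2 format holds with the unit contact monomial `N = ⊤` and the EMPTY boundary.  Content = the KEY
OBSERVATION: stub-1's `DepthFlag.exists_generator_host_not_mem_sq_of_flag` (host generator outside `𝔪²` at every point of
`i(E) ∩ cosupp K`, from `ord_x (coeffFlag 0 K ⊔ (coeffFlag 1 K)²) ≤ 1`), `𝓗|_E = K|_E` (`HostMonoFormat`, `𝓘_E²|_E = 0`), and the
pocket field being vacuous at an initial state (`cosupp K ⊆ i(E)` — inherited from stage 1's literal contact: `𝓘_E² ≤ K`).
[cite: KawanoueMatsuki2016, §2] [cite: Kollar2007, (3.111) Step 3] -/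
def InitialSep
    (Q₁ : ∀ ⦃E X : Scheme.{u}⦄, (E ⟶ X) → X.IdealSheafData → E.IdealSheafData → Prop)
    (Q : ∀ ⦃E X : Scheme.{u}⦄, (E ⟶ X) → X.IdealSheafData → X.IdealSheafData → List (E.IdealSheafData × ℕ) → Prop) :
    Prop :=
  ∀ (S : Type u) [CommRing S] [IsRegularLocalRing S] (I : Ideal S)
    (E X : Scheme.{u}) (i : E ⟶ X) (g : X ⟶ Spec (.of S)) (K : X.IdealSheafData) (R₁ : E.IdealSheafData),
    DepthInvariant 2 S I E X i g K → Q₁ i K R₁ → EndFlag (K.comap i) R₁ →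
      Q i K ⊤ ([] : List (E.IdealSheafData × ℕ))


end Summit.ResolutionOfSingularities.ResolutionOfSingularities.Theorems.DepthTargets

end
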